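import Mathlib.LinearAlgebra.FiniteDimensional.Lemmas
import Literature.AlgebraicGeometry.Motives.FaltingsECTateHomProofs
import Literature.AlgebraicGeometry.Motives.FaltingsECIsogenyProofs
import HarnessLib

/-!
# Faltings 1983, Korollar 1 for a pair of elliptic curves from subspace realization for `E × E'`

D-0014 keeps `Literature/` sorry-free by stating cited results as named facts `def X : Prop`.
This sibling proof file of `Literature.AlgebraicGeometry.Motives.FaltingsEC` concerns the named
fact `Literature.Hodge.mem_span_range_tateModule_map_of_equivariant W W' ℓ` — the elliptic-curve case of
G. Faltings, *Endlichkeitssätze für abelsche Varietäten über Zahlkörpern*, Invent. Math. 73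
(1983), §5, Satz 4 with **Korollar 1**: for abelian varieties `A₁, A₂` over a number field `K`
and a prime `ℓ`, `Hom_K(A₁, A₂) ⊗_ℤ ℤ_ℓ → Hom_π(T_ℓ(A₁), T_ℓ(A₂))` (`π = Gal(K̄/K)`) is an
isomorphism; here `A₁ = E`, `A₂ = E'` are elliptic curves and the fact says that every
`Γ_K`-equivariant `ℤ_ℓ`-linear map `T_ℓ E → T_ℓ E'` is a `ℤ_ℓ`-combination of the maps `T_ℓ φ`,
`φ : E → E'` an isogeny over `K`. The printed proof of Korollar 1 is one line: "Theorem 4 applied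
to `A₁ × A₂`" (English translation: G. Cornell, J. H. Silverman (eds.), *Arithmetic Geometry*,
Springer 1986, Ch. II, §5, Corollary 1). This file carries out that line for elliptic curves,
sorry-free, down to the **one** deep input that Faltings' proof of Satz 4 produces for the abelian
surface `A = E × E'` — the realization of `Γ_K`-stable subspaces of
`V_ℓ(E × E') = V_ℓ E ⊕ V_ℓ E'` as images of elements of
`End_K(E × E') ⊗ ℚ_ℓ = (End_K(E) ⊗ ℚ_ℓ, Hom_K(E', E) ⊗ ℚ_ℓ; Hom_K(E, E') ⊗ ℚ_ℓ, End_K(E') ⊗ ℚ_ℓ)`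
("it follows that `W` is the image of an idempotent in `End_K(A) ⊗_ℤ ℚ_ℓ`", loc. cit., proof of
Sätze 3–4, from Satz 1 and Satz 2) — and three results of the elementary theory of isogenies
which the tree states as named facts (Silverman, *AEC*, III.4.11, III.6.1, III.9.4).

It complements `Literature.AlgebraicGeometry.Motives.FaltingsECTateHomProofs`, whose reduction
`mem_span_range_tateModule_map_of_equivariant_of_subspaces` uses subspace realization for
`E' × E'` **and** Faltings' Korollar 2 for `(E, E')` (two deep inputs); here Korollar 2 is not
needed, in accordance with the printed order Satz 4 ⟹ Korollar 1 ⟹ Korollar 2.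

## The argument

Write `V = V_ℓ E`, `V' = V_ℓ E'` (`dim_{ℚ_ℓ} = 2`), `E_ℓ = image(End_K(E) ⊗ ℚ_ℓ → End V)`
(`Literature.Hodge.rationalEndSpan W ℓ` of `FaltingsECSubspaces`), `H_ℓ(E, E') ⊆ Hom(V, V')` for the
`ℚ_ℓ`-span of the `1 ⊗ T_ℓ φ`, `φ : E → E'` an isogeny over `K` (the image of
`Hom_K(E, E') ⊗ ℚ_ℓ`), and similarly `H_ℓ(E', E)`, `E'_ℓ`.

1. (`mem_span_baseChange_tateModule_map_of_subspaces_pair`, the `ℚ_ℓ`-form of Korollar 1.) Let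
   `G : V → V'` be `ℚ_ℓ`-linear and `Γ_K`-equivariant. Its graph is a `Γ_K`-stable subspace of
   `V × V'`, so by the deep input it is the image of `(x, y) ↦ (a x + b y, c x + d y)` with
   `a ∈ E_ℓ`, `b ∈ H_ℓ(E', E)`, `c ∈ H_ℓ(E, E')`, `d ∈ E'_ℓ`; hence `c = G a`, `d = G b` and
   `a V + b V' = V` (`Literature.AlgebraicGeometry.Motives.forall_of_graph_eq_range`).
   * If there is no isogeny `E' → E` over `K`, then `b = 0`, `a` is onto hence invertible, its
     inverse lies in `E_ℓ` (`Literature.AlgebraicGeometry.Motives.comp_mem_of_comp_eq_one`: in dimension two `a⁻¹ ∈ ℚ_ℓ + ℚ_ℓ a`),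
     and `G = c a⁻¹ ∈ H_ℓ(E, E') ∘ E_ℓ ⊆ H_ℓ(E, E')`.
   * Otherwise take `ψ₀ : E' → E` and, by the dual isogeny, `φ₁ : E → E'` with `φ₁ ∘ ψ₀ = [n]`,
     `n ≥ 1`; put `Φ = 1 ⊗ T_ℓ φ₁ : V → V'`, `Ψ = 1 ⊗ T_ℓ ψ₀ : V' → V`, so `Φ Ψ = n`. The graph of
     `G' = n⁻¹ Ψ G ∈ End V` is the image of `(x, y') ↦ (a x + b Φ y', n⁻¹ Ψ c x + n⁻¹ Ψ d Φ y')`,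
     whose entries `a, b Φ, Ψ c, Ψ d Φ` lie in the commutative algebra `E_ℓ ∋ 1` (composites of
     isogenies are isogenies; `End_K = {0} ∪ {isogenies}`; `End_{K̄}(E)` is commutative in
     characteristic `0`), so `G' ∈ E_ℓ` by the graph argument in dimension two of
     `FaltingsECEndomorphismsProofs` (`Literature.AlgebraicGeometry.Motives.mem_of_graph_eq_range`), packaged here as
     `Literature.AlgebraicGeometry.Motives.comp_mem_of_graph_eq_range_pair`; and `G = n⁻¹ Φ (Ψ G) ∈ Φ E_ℓ ⊆ H_ℓ(E, E')`.
2. (`mem_span_range_tateModule_map_of_rational`,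
   `mem_span_range_tateModule_map_of_equivariant_of_rational`: "it suffices to prove the
   `ℚ_ℓ`-statement", the first paragraph of Faltings' proof, for `Hom`.) For a `Γ_K`-equivariant
   `ℤ_ℓ`-linear `f : T_ℓ E → T_ℓ E'`, `1 ⊗ f ∈ H_ℓ(E, E')`; clearing denominators and using the
   injectivity of base change on `Hom_{ℤ_ℓ}(T_ℓ E, T_ℓ E')` (`T_ℓ E'` is torsion-free, hence flat,
   over `ℤ_ℓ`) gives `b f ∈ ℤ_ℓ · {T_ℓ φ}` for some `b ≠ 0`, and the saturation of `ℤ_ℓ · {T_ℓ φ}`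
   in `Hom(T_ℓ E, T_ℓ E')` proved in the tree from *AEC* III.4.11
   (`mem_span_tateModule_map_of_smul_mem`, `FaltingsECTateLemma1Proofs`; Tate 1966, §1, Lemma 1)
   removes `b` (`Literature.AlgebraicGeometry.Motives.mem_of_padicInt_smul_mem`).
3. (`mem_span_range_tateModule_map_of_equivariant_of_subspaces_pair`.) The named fact follows from
   the subspace statement for `E × E'` (`hX`, spelled out with `V_ℓ E × V_ℓ E'`, `E_ℓ`, `E'_ℓ` and
   the two `Hom`-spans), `WeierstrassCurve.geomEndRing_comm` (*AEC* III.9.4),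
   `Isogeny.exists_dual` for `(E', E)` (*AEC* III.6.1) and
   `Isogeny.exists_eq_comp_nsmul_of_geomTorsion_le_ker W W'` (*AEC* III.4.11); the remaining
   elementary inputs are discharged in the tree (`WeierstrassCurve.mem_geomEndRing_iff_holds`,
   `Isogeny.nonempty_comp_holds`, `WeierstrassCurve.finrank_rationalTateModule_eq_two_holds`).

The statement `hX` is vendored as a named fact in the companion statement file
`Literature.AlgebraicGeometry.Motives.FaltingsECSubspacesHom` (proposed separately), which derives
the named fact from it by name.

## Mathlib

Used: `LinearMap.graph`, `LinearMap.coprod`, `LinearMap.prod`, `LinearMap.isUnit_iff_range_eq_top`,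
`Module.finite_of_finrank_eq_succ`, `Module.nontrivial_of_finrank_eq_succ`, `LinearMap.baseChange`
with `baseChange_comp`/`baseChange_smul`/`baseChange_id`/`baseChange_zero`,
`LinearMap.baseChangeHom_injective` (flat modules; `Module.Flat` from `Module.IsTorsionFree` over a
Dedekind domain), `IsLocalization.exist_integer_multiples`,
`Finsupp.mem_span_range_iff_exists_finsupp`, `Submodule.span_induction`. From the tree:
`Literature.AlgebraicGeometry.Motives.mem_of_graph_eq_range`, `Literature.AlgebraicGeometry.Motives.exists_eq_smul_one_add_smul_of_commute`,
`Literature.AlgebraicGeometry.Motives.mem_of_padicInt_smul_mem`, `commute_of_mem_span_range_baseChange_tateEndRingHom`,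
`eq_zero_or_exists_isogeny_of_mem_endRing` (`FaltingsECEndomorphismsProofs`); `rationalEndSpan`,
`one_mem_rationalEndSpan`, `baseChange_tateEndRingHom_mem_rationalEndSpan` (`FaltingsECSubspaces`);
`mem_span_tateModule_map_of_smul_mem` (`FaltingsECTateLemma1Proofs`);
`WeierstrassCurve.mem_geomEndRing_iff_holds`, `Isogeny.nonempty_comp_holds`,
`WeierstrassCurve.finrank_rationalTateModule_eq_two_holds`, `Literature.NumberTheory.EllipticCurves.TateModule.proj_natCast_smul`,
`Literature.NumberTheory.EllipticCurves.TateModule.map_comp`, `Literature.NumberTheory.EllipticCurves.TateModule.map_zero`.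

## References

* [Faltings1983Endlichkeit] G. Faltings, *Endlichkeitssätze für abelsche Varietäten über
  Zahlkörpern*, Invent. Math. 73 (1983), 349–366, §5: Satz 4, Korollar 1 ("Theorem 4 applied to
  `A₁ × A₂`"), and the proof of Sätze 3–4 (first paragraph: reduction to `ℚ_ℓ`; p. 18 of the
  translation: "`W` is the image of an idempotent in `End_K(A) ⊗_ℤ ℚ_ℓ`"); English translation:
  [Faltings1986FinitenessTranslation] Ch. II of G. Cornell, J. H. Silverman (eds.), *Arithmetic
  Geometry*, Springer 1986, §5 (Theorems 3–4, Corollary 1).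
* [Tate1966Endomorphisms] J. Tate, *Endomorphisms of abelian varieties over finite fields*,
  Invent. Math. 2 (1966), 134–144, §1 (Lemma 1), §2 (the argument with `A × A`).
* [SilvermanAEC2009] J. H. Silverman, *The Arithmetic of Elliptic Curves*, 2nd ed., GTM 106,
  III.§4 (Cor. III.4.11), III.§6 (Thm. III.6.1, dual isogeny), III.§7 (Thm. III.7.4, III.7.7),
  III.§9 (Cor. III.9.4).

## Design choices

* `noncomputable section`, `namespace Literature.Hodge`, base field `K : Type u` in a named universe, as
  in `FaltingsEC`; no `def`s (a pure proof file): `H_ℓ(E, E')` is written out as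
  `Submodule.span ℚ_[ℓ] (Set.range (fun φ : Isogeny W W' ↦ (T_ℓ φ).baseChange ℚ_[ℓ]) : Set (V_ℓ E →ₗ V_ℓ E'))`
  with the `Set` ascribed to the Hom-space of the preludes' `rationalTateModule` synonyms (so that
  it matches `rationalEndSpan` and the statement file), while `E_ℓ`, `E'_ℓ` are the tree's
  `rationalEndSpan`.
* The deep input `hX` and the three *AEC* facts enter as explicit hypotheses; in the working
  `ℚ_ℓ`-theorem the dual isogeny enters in the weak elementary form "`∀ ψ : E' → E`,
  `∃ φ : E → E'`, `∃ n ≥ 1`, `φ ∘ ψ = [n]`", fed from `Isogeny.exists_dual` (with `n = deg ψ`) in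
  the assembled theorem. Only isogenies `E' → E` need duals, and no symmetry of isogeny is used:
  the case without isogenies `E' → E` is settled by inverting `a` inside `E_ℓ`.
* The linear algebra (`Literature.AlgebraicGeometry.Motives.graph_eq_range_of_forall`, `Literature.AlgebraicGeometry.Motives.forall_of_graph_eq_range`,
  `Literature.AlgebraicGeometry.Motives.comp_mem_of_graph_eq_range_pair`, `Literature.AlgebraicGeometry.Motives.comp_mem_of_comp_eq_one`) is stated for any field
  and any spaces, and the span lemmas `Literature.AlgebraicGeometry.Motives.comp_mem_of_mem_span`, `Literature.AlgebraicGeometry.Motives.mem_comp_of_mem_span` for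
  any field.
* The working descent lemma `mem_span_range_tateModule_map_of_rational` is phrased with the bare
  tensor product `ℚ_[ℓ] ⊗[ℤ_[ℓ]] T_ℓ` and the base-changed `galoisRepTate` (definitionally
  `rationalTateModule`/`rationalGaloisRepTate`), like its `End` analogue
  `mem_span_range_tateEndRingHom_of_rational` in the tree, so that `rw` with `baseChange_comp`
  applies verbatim; the assembled theorems convert by `LinearMap.congr_fun`.
-/

noncomputable section

open scoped TensorProduct

universe u

/-! ## Linear algebra: the graph argument for a pair of spaces -/

namespace Literature.AlgebraicGeometry.Motives

section PairGraph

open Module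

variable {F : Type*} [Field F]
variable {X Z P Y : Type*} [AddCommGroup X] [Module F X] [AddCommGroup Z] [Module F Z]
  [AddCommGroup P] [Module F P] [AddCommGroup Y] [Module F Y]

/-- The graph of `α : P → Y` is the image of `(x, z) ↦ (a x + b z, c x + d z)` as soon as
`c x + d z = α (a x + b z)` identically and `a X + b Z = P`. [folklore] -/
theorem graph_eq_range_of_forall {α : P →ₗ[F] Y} {a : X →ₗ[F] P} {b : Z →ₗ[F] P}
    {c : X →ₗ[F] Y} {d : Z →ₗ[F] Y} (hkey : ∀ x z, c x + d z = α (a x + b z))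
    (hsurj : ∀ v, ∃ x z, a x + b z = v) :
    LinearMap.graph α = LinearMap.range ((a.coprod b).prod (c.coprod d)) := by
  ext ⟨v, w⟩
  rw [LinearMap.mem_graph_iff, LinearMap.mem_range]
  constructor
  · rintro (hw : w = α v)
    obtain ⟨x, z, hxz⟩ := hsurj v
    exact ⟨(x, z), by simp [hxz, hkey, hw]⟩
  · rintro ⟨⟨x, z⟩, hxz⟩
    have h₁ : a x + b z = v := by simpa using congrArg Prod.fst hxz
    have h₂ : c x + d z = w := by simpa using congrArg Prod.snd hxz
    change w = α v
    rw [← h₁, ← hkey, h₂]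

/-- Conversely, if the graph of `α` is the image of `(x, z) ↦ (a x + b z, c x + d z)` then
`c x + d z = α (a x + b z)` identically and `a X + b Z = P`. [folklore] -/
theorem forall_of_graph_eq_range {α : P →ₗ[F] Y} {a : X →ₗ[F] P} {b : Z →ₗ[F] P}
    {c : X →ₗ[F] Y} {d : Z →ₗ[F] Y}
    (h : LinearMap.graph α = LinearMap.range ((a.coprod b).prod (c.coprod d))) :
    (∀ x z, c x + d z = α (a x + b z)) ∧ ∀ v, ∃ x z, a x + b z = v := by
  refine ⟨fun x z ↦ ?_, fun v ↦ ?_⟩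
  · have hmem : ((a.coprod b).prod (c.coprod d)) (x, z) ∈ LinearMap.graph α :=
      h ▸ LinearMap.mem_range_self _ _
    simpa [LinearMap.mem_graph_iff] using hmem
  · have hv : (v, α v) ∈ LinearMap.range ((a.coprod b).prod (c.coprod d)) :=
      h ▸ (α.mem_graph_iff (v, α v)).mpr rfl
    obtain ⟨⟨x, z⟩, hxz⟩ := hv
    exact ⟨x, z, by simpa using congrArg Prod.fst hxz⟩

variable {V V' : Type*} [AddCommGroup V] [Module F V] [AddCommGroup V'] [Module F V']

/-- **The graph argument for a pair of two-dimensional spaces.** Let `E ⊆ End(V)` contain `1`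
and consist of pairwise commuting endomorphisms, `dim V = 2`, and let `Φ : V → V'`, `Ψ : V' → V`
satisfy `Φ Ψ = n ≠ 0`. If the graph of `G : V → V'` is the image of
`(x, y) ↦ (a x + b y, c x + d y)` (`a ∈ End V`, `b : V' → V`, `c : V → V'`, `d ∈ End V'`) with
`a`, `b Φ`, `Ψ c`, `Ψ d Φ ∈ E`, then `Ψ G ∈ E`: the graph of `G' = n⁻¹ Ψ G ∈ End(V)` is the image of
`(x, y') ↦ (a x + b Φ y', n⁻¹ Ψ c x + n⁻¹ Ψ d Φ y')` (substitute `y = Φ y'`, `y' = n⁻¹ Ψ y`), so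
`G' ∈ E` by the graph argument in dimension two (`Literature.AlgebraicGeometry.Motives.mem_of_graph_eq_range`). This is the
reduction of Faltings' Korollar 1 ("Theorem 4 applied to `A₁ × A₂`") to the centralizer step of
Tate's argument, for a pair of elliptic curves linked by an isogeny `φ₀` with dual `ψ₀`
(`Φ = V_ℓ φ₀`, `Ψ = V_ℓ ψ₀`, `n = deg φ₀`). Tate, Invent. Math. 2 (1966), §2; [folklore] -/
theorem comp_mem_of_graph_eq_range_pair (h2 : finrank F V = 2) {E : Submodule F (Module.End F V)}
    (h1 : (1 : Module.End F V) ∈ E) (hE : ∀ s ∈ E, ∀ t ∈ E, s * t = t * s)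
    {Φ : V →ₗ[F] V'} {Ψ : V' →ₗ[F] V} {n : F} (hn : n ≠ 0) (hΦΨ : Φ ∘ₗ Ψ = n • LinearMap.id)
    {G : V →ₗ[F] V'} {a : Module.End F V} {b : V' →ₗ[F] V} {c : V →ₗ[F] V'}
    {d : Module.End F V'} (ha : a ∈ E) (hb : b ∘ₗ Φ ∈ E) (hc : Ψ ∘ₗ c ∈ E)
    (hd : Ψ ∘ₗ d ∘ₗ Φ ∈ E)
    (h : LinearMap.graph G = LinearMap.range ((a.coprod b).prod (c.coprod d))) :
    Ψ ∘ₗ G ∈ E := by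
  obtain ⟨hkey, hsurj⟩ := forall_of_graph_eq_range h
  have hΦΨ' : ∀ y, Φ (Ψ y) = n • y := fun y ↦ by
    simpa using LinearMap.congr_fun hΦΨ y
  set G' : Module.End F V := n⁻¹ • (Ψ ∘ₗ G) with hG'def
  have hG' : G' ∈ E := by
    refine mem_of_graph_eq_range h2 h1 hE ha hb (E.smul_mem n⁻¹ hc) (E.smul_mem n⁻¹ hd)
      (graph_eq_range_of_forall (fun x z ↦ ?_) (fun v ↦ ?_))
    · have hk := hkey x (Φ z)
      simp only [hG'def, LinearMap.smul_apply, LinearMap.comp_apply]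
      rw [← smul_add, ← map_add, hk]
    · obtain ⟨x, y, hxy⟩ := hsurj v
      refine ⟨x, n⁻¹ • Ψ y, ?_⟩
      rw [LinearMap.comp_apply, map_smul, hΦΨ', smul_smul, inv_mul_cancel₀ hn, one_smul, hxy]
  have hΨG : Ψ ∘ₗ G = n • G' := by
    rw [hG'def, smul_smul, mul_inv_cancel₀ hn, one_smul]
  rw [hΨG]
  exact E.smul_mem n hG'

/-- In a two-dimensional space, the inverse of an invertible element `a` of a subspace
`E ⊆ End(V)` containing `1` lies in `E`: if `a = λ` is a scalar then `a⁻¹ = λ⁻¹`, otherwise `a⁻¹`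
commutes with the non-scalar `a` and `a⁻¹ ∈ F + F a` (`Literature.AlgebraicGeometry.Motives.exists_eq_smul_one_add_smul_of_commute`;
Cayley–Hamilton in dimension two). [folklore] -/
theorem comp_mem_of_comp_eq_one (h2 : finrank F V = 2) {E : Submodule F (Module.End F V)}
    (h1 : (1 : Module.End F V) ∈ E) {a a' : Module.End F V} (ha : a ∈ E)
    (hinv : a * a' = 1) (hinv' : a' * a = 1) : a' ∈ E := by
  haveI : Nontrivial V := Module.nontrivial_of_finrank_eq_succ h2
  by_cases hsc : ∃ la : F, a = la • 1
  · obtain ⟨la, rfl⟩ := hsc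
    have hla : la ≠ 0 := by
      rintro rfl
      rw [zero_smul, zero_mul] at hinv
      exact zero_ne_one hinv
    have : a' = la⁻¹ • 1 := by
      have := congrArg (fun t ↦ la⁻¹ • t) hinv
      simpa [smul_mul_assoc, smul_smul, inv_mul_cancel₀ hla] using this
    rw [this]
    exact E.smul_mem _ h1
  · have hcomm : a' * a = a * a' := by rw [hinv, hinv']
    obtain ⟨p, q, rfl⟩ := exists_eq_smul_one_add_smul_of_commute h2 hsc hcomm
    exact E.add_mem (E.smul_mem _ h1) (E.smul_mem _ ha)

end PairGraph

end Literature.AlgebraicGeometry.Motives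

/-! ## Two lemmas on spans of linear maps -/

namespace Literature.AlgebraicGeometry.Motives

variable {R M N P : Type*} [Field R] [AddCommGroup M] [Module R M] [AddCommGroup N] [Module R N]
  [AddCommGroup P] [Module R P]

/-- Postcomposition with `g` maps `span S` into a subspace `T` as soon as it maps `S` into `T`.
[folklore] -/
theorem comp_mem_of_mem_span (g : N →ₗ[R] P) {S : Set (M →ₗ[R] N)}
    {T : Submodule R (M →ₗ[R] P)} (hgen : ∀ s ∈ S, g ∘ₗ s ∈ T) {x : M →ₗ[R] N}
    (hx : x ∈ Submodule.span R S) : g ∘ₗ x ∈ T := by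
  induction hx using Submodule.span_induction with
  | mem x h => exact hgen x h
  | zero => rw [LinearMap.comp_zero]; exact T.zero_mem
  | add x y _ _ hx hy => rw [LinearMap.comp_add]; exact T.add_mem hx hy
  | smul c x _ hx => rw [LinearMap.comp_smul]; exact T.smul_mem c hx

/-- Precomposition with `f` maps `span S` into a subspace `T` as soon as it maps `S` into `T`.
[folklore] -/
theorem mem_comp_of_mem_span (f : M →ₗ[R] N) {S : Set (N →ₗ[R] P)}
    {T : Submodule R (M →ₗ[R] P)} (hgen : ∀ s ∈ S, s ∘ₗ f ∈ T) {x : N →ₗ[R] P}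
    (hx : x ∈ Submodule.span R S) : x ∘ₗ f ∈ T := by
  induction hx using Submodule.span_induction with
  | mem x h => exact hgen x h
  | zero => rw [LinearMap.zero_comp]; exact T.zero_mem
  | add x y _ _ hx hy => rw [LinearMap.add_comp]; exact T.add_mem hx hy
  | smul c x _ hx => rw [LinearMap.smul_comp]; exact T.smul_mem c hx

end Literature.AlgebraicGeometry.Motives

namespace Literature.AlgebraicGeometry.Motives

open WeierstrassCurve

variable {K : Type u} [Field K] {W W' W'' : WeierstrassCurve K} (ℓ : ℕ) [Fact ℓ.Prime]

/-! ## Tate-module maps of composites and duals, over `ℚ_ℓ` -/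

/-- `V_ℓ` of a composite: if `ρ = ψ ∘ φ` on `K̄`-points then `1 ⊗ T_ℓ ρ = (1 ⊗ T_ℓ ψ) ∘ (1 ⊗ T_ℓ φ)`.
[folklore] -/
theorem baseChange_tateModule_map_eq_comp {ρ : Isogeny W W''} {ψ : Isogeny W' W''}
    {φ : Isogeny W W'} (h : ∀ P, ρ P = ψ (φ P)) :
    ((Literature.NumberTheory.EllipticCurves.TateModule.map ℓ ρ.toAddMonoidHom).baseChange ℚ_[ℓ] :
        W.rationalTateModule ℓ →ₗ[ℚ_[ℓ]] W''.rationalTateModule ℓ) =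
      ((Literature.NumberTheory.EllipticCurves.TateModule.map ℓ ψ.toAddMonoidHom).baseChange ℚ_[ℓ] :
          W'.rationalTateModule ℓ →ₗ[ℚ_[ℓ]] W''.rationalTateModule ℓ) ∘ₗ
        ((Literature.NumberTheory.EllipticCurves.TateModule.map ℓ φ.toAddMonoidHom).baseChange ℚ_[ℓ] :
          W.rationalTateModule ℓ →ₗ[ℚ_[ℓ]] W'.rationalTateModule ℓ) := by
  have hρ : ρ.toAddMonoidHom = ψ.toAddMonoidHom.comp φ.toAddMonoidHom :=
    AddMonoidHom.ext fun P ↦ by simpa using h P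
  rw [hρ, Literature.NumberTheory.EllipticCurves.TateModule.map_comp, LinearMap.baseChange_comp]

/-- `V_ℓ` of a dual pair: if `φ ∘ ψ = [n]` on `K̄`-points then `(1 ⊗ T_ℓ φ) ∘ (1 ⊗ T_ℓ ψ) = n`
on `V_ℓ E'`. Silverman, *AEC*, III.6.1–6.2 with III.7.4. [folklore] -/
theorem baseChange_tateModule_map_comp_eq_smul {φ : Isogeny W W'} {ψ : Isogeny W' W} {n : ℕ}
    (h : ∀ Q, φ (ψ Q) = (n : ℤ) • Q) :
    ((Literature.NumberTheory.EllipticCurves.TateModule.map ℓ φ.toAddMonoidHom).baseChange ℚ_[ℓ] :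
          W.rationalTateModule ℓ →ₗ[ℚ_[ℓ]] W'.rationalTateModule ℓ) ∘ₗ
        ((Literature.NumberTheory.EllipticCurves.TateModule.map ℓ ψ.toAddMonoidHom).baseChange ℚ_[ℓ] :
          W'.rationalTateModule ℓ →ₗ[ℚ_[ℓ]] W.rationalTateModule ℓ) =
      (n : ℚ_[ℓ]) • LinearMap.id := by
  have hT : Literature.NumberTheory.EllipticCurves.TateModule.map ℓ φ.toAddMonoidHom ∘ₗ Literature.NumberTheory.EllipticCurves.TateModule.map ℓ ψ.toAddMonoidHom =
      (n : ℤ_[ℓ]) • LinearMap.id := by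
    refine LinearMap.ext fun x ↦ Literature.NumberTheory.EllipticCurves.TateModule.ext fun k ↦ ?_
    rw [LinearMap.comp_apply, Literature.NumberTheory.EllipticCurves.TateModule.proj_map, Literature.NumberTheory.EllipticCurves.TateModule.proj_map, LinearMap.smul_apply,
      LinearMap.id_apply, Literature.NumberTheory.EllipticCurves.TateModule.proj_natCast_smul, Isogeny.coe_toAddMonoidHom,
      Isogeny.coe_toAddMonoidHom, h, natCast_zsmul]
  have hbc := congrArg (LinearMap.baseChange ℚ_[ℓ]) hT
  rw [LinearMap.baseChange_comp, LinearMap.baseChange_smul, LinearMap.baseChange_id] at hbc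
  rw [hbc, Nat.cast_smul_eq_nsmul, Nat.cast_smul_eq_nsmul]

/-- The base change of the Tate-module map of an isogeny `E → E` lies in
`E_ℓ = image(End_K(E) ⊗ ℚ_ℓ)` (`rationalEndSpan W ℓ`): an isogeny `E → E` over `K` is an element
of `End_K(E)` (`Isogeny.toAddMonoidHom_mem_endRing`). [folklore] -/
theorem baseChange_tateModule_map_mem_rationalEndSpan (χ : Isogeny W W) :
    ((Literature.NumberTheory.EllipticCurves.TateModule.map ℓ χ.toAddMonoidHom).baseChange ℚ_[ℓ] :
        Module.End ℚ_[ℓ] (W.rationalTateModule ℓ)) ∈ rationalEndSpan W ℓ :=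
  baseChange_tateEndRingHom_mem_rationalEndSpan W ℓ ⟨χ.toAddMonoidHom, χ.toAddMonoidHom_mem_endRing⟩

/-- For isogenies `φ : E → E'`, `ψ : E' → E` over `K`, the composite `(1 ⊗ T_ℓ ψ) ∘ (1 ⊗ T_ℓ φ)`
is `1 ⊗ T_ℓ (ψ ∘ φ)` with `ψ ∘ φ ∈ End_K(E)` (composites of isogenies are isogenies, the tree's
`Isogeny.nonempty_comp_holds`, Silverman, *AEC*, III.§4), hence lies in `E_ℓ`. [folklore] -/
theorem comp_mem_rationalEndSpan (ψ : Isogeny W' W) (φ : Isogeny W W') :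
    ((Literature.NumberTheory.EllipticCurves.TateModule.map ℓ ψ.toAddMonoidHom).baseChange ℚ_[ℓ] :
          W'.rationalTateModule ℓ →ₗ[ℚ_[ℓ]] W.rationalTateModule ℓ) ∘ₗ
        ((Literature.NumberTheory.EllipticCurves.TateModule.map ℓ φ.toAddMonoidHom).baseChange ℚ_[ℓ] :
          W.rationalTateModule ℓ →ₗ[ℚ_[ℓ]] W'.rationalTateModule ℓ) ∈ rationalEndSpan W ℓ := by
  obtain ⟨ρ, hρ⟩ := Isogeny.nonempty_comp_holds W W' ψ φ
  rw [← baseChange_tateModule_map_eq_comp ℓ hρ]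
  exact baseChange_tateModule_map_mem_rationalEndSpan ℓ ρ

/-- For an isogeny `φ : E → E'` over `K` and `χ ∈ End_K(E)` (`E` elliptic), the composite
`(1 ⊗ T_ℓ φ) ∘ (1 ⊗ T_ℓ χ)` lies in `H_ℓ(E, E')`, the `ℚ_ℓ`-span of the `1 ⊗ T_ℓ ρ`,
`ρ : E → E'` an isogeny over `K`: `χ` is `0` or an isogeny (`W.mem_geomEndRing_iff_holds`,
Silverman, *AEC*, III.§4), and `φ ∘ χ` is then an isogeny `E → E'`. [folklore] -/
theorem comp_mem_span_of_mem_endRing [W.IsElliptic] (φ : Isogeny W W') (χ : W.endRing) :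
    ((Literature.NumberTheory.EllipticCurves.TateModule.map ℓ φ.toAddMonoidHom).baseChange ℚ_[ℓ] :
          W.rationalTateModule ℓ →ₗ[ℚ_[ℓ]] W'.rationalTateModule ℓ) ∘ₗ
        ((tateEndRingHom W ℓ χ).baseChange ℚ_[ℓ] : Module.End ℚ_[ℓ] (W.rationalTateModule ℓ)) ∈
      Submodule.span ℚ_[ℓ] (Set.range (fun ρ : Isogeny W W' ↦
        (Literature.NumberTheory.EllipticCurves.TateModule.map ℓ ρ.toAddMonoidHom).baseChange ℚ_[ℓ]) :
          Set (W.rationalTateModule ℓ →ₗ[ℚ_[ℓ]] W'.rationalTateModule ℓ)) := by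
  rcases eq_zero_or_exists_isogeny_of_mem_endRing W (mem_geomEndRing_iff_holds W) χ.2 with h0 | ⟨χ', hχ'⟩
  · have : tateEndRingHom W ℓ χ = 0 := by
      rw [tateEndRingHom_apply, h0]
      exact Literature.NumberTheory.EllipticCurves.TateModule.map_zero
    rw [this, LinearMap.baseChange_zero, LinearMap.comp_zero]
    exact Submodule.zero_mem _
  · obtain ⟨ρ, hρ⟩ := Isogeny.nonempty_comp_holds W W φ χ'
    have hT : tateEndRingHom W ℓ χ = Literature.NumberTheory.EllipticCurves.TateModule.map ℓ χ'.toAddMonoidHom := by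
      rw [tateEndRingHom_apply, ← hχ']
    rw [hT, ← baseChange_tateModule_map_eq_comp ℓ hρ]
    exact Submodule.subset_span ⟨ρ, rfl⟩

/-- For isogenies `φ : E → E'`, `ψ : E' → E` over `K` and `χ ∈ End_K(E')` (`E'` elliptic), the
composite `(1 ⊗ T_ℓ ψ) ∘ (1 ⊗ T_ℓ χ) ∘ (1 ⊗ T_ℓ φ)` lies in `E_ℓ = image(End_K(E) ⊗ ℚ_ℓ)`:
`χ` is `0` or an isogeny, and `ψ ∘ χ ∘ φ ∈ End_K(E)`. [folklore] -/
theorem comp_comp_mem_rationalEndSpan [W'.IsElliptic] (ψ : Isogeny W' W) (χ : W'.endRing)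
    (φ : Isogeny W W') :
    ((Literature.NumberTheory.EllipticCurves.TateModule.map ℓ ψ.toAddMonoidHom).baseChange ℚ_[ℓ] :
          W'.rationalTateModule ℓ →ₗ[ℚ_[ℓ]] W.rationalTateModule ℓ) ∘ₗ
        ((tateEndRingHom W' ℓ χ).baseChange ℚ_[ℓ] : Module.End ℚ_[ℓ] (W'.rationalTateModule ℓ)) ∘ₗ
        ((Literature.NumberTheory.EllipticCurves.TateModule.map ℓ φ.toAddMonoidHom).baseChange ℚ_[ℓ] :
          W.rationalTateModule ℓ →ₗ[ℚ_[ℓ]] W'.rationalTateModule ℓ) ∈ rationalEndSpan W ℓ := by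
  rcases eq_zero_or_exists_isogeny_of_mem_endRing W' (mem_geomEndRing_iff_holds W') χ.2 with
    h0 | ⟨χ', hχ'⟩
  · have : tateEndRingHom W' ℓ χ = 0 := by
      rw [tateEndRingHom_apply, h0]
      exact Literature.NumberTheory.EllipticCurves.TateModule.map_zero
    rw [this, LinearMap.baseChange_zero, LinearMap.zero_comp, LinearMap.comp_zero]
    exact Submodule.zero_mem _
  · obtain ⟨ρ, hρ⟩ := Isogeny.nonempty_comp_holds W W' χ' φ
    have hT : tateEndRingHom W' ℓ χ = Literature.NumberTheory.EllipticCurves.TateModule.map ℓ χ'.toAddMonoidHom := by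
      rw [tateEndRingHom_apply, ← hχ']
    rw [hT, ← baseChange_tateModule_map_eq_comp ℓ hρ]
    exact comp_mem_rationalEndSpan ℓ ψ ρ

/-! ## The same for elements of the spans -/

/-- Precomposition with `1 ⊗ T_ℓ φ₁` (`φ₁ : E → E'`) maps `H_ℓ(E', E)` into `E_ℓ`. [folklore] -/
theorem comp_mem_rationalEndSpan_of_mem_span (φ₁ : Isogeny W W')
    {b : W'.rationalTateModule ℓ →ₗ[ℚ_[ℓ]] W.rationalTateModule ℓ}
    (hb : b ∈ Submodule.span ℚ_[ℓ] (Set.range (fun ψ : Isogeny W' W ↦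
      (Literature.NumberTheory.EllipticCurves.TateModule.map ℓ ψ.toAddMonoidHom).baseChange ℚ_[ℓ]) :
        Set (W'.rationalTateModule ℓ →ₗ[ℚ_[ℓ]] W.rationalTateModule ℓ))) :
    b ∘ₗ ((Literature.NumberTheory.EllipticCurves.TateModule.map ℓ φ₁.toAddMonoidHom).baseChange ℚ_[ℓ] :
        W.rationalTateModule ℓ →ₗ[ℚ_[ℓ]] W'.rationalTateModule ℓ) ∈ rationalEndSpan W ℓ := by
  refine mem_comp_of_mem_span _ ?_ hb
  rintro _ ⟨ψ, rfl⟩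
  exact comp_mem_rationalEndSpan ℓ ψ φ₁

/-- Postcomposition with `1 ⊗ T_ℓ ψ₀` (`ψ₀ : E' → E`) maps `H_ℓ(E, E')` into `E_ℓ`. [folklore] -/
theorem comp_mem_rationalEndSpan_of_mem_span' (ψ₀ : Isogeny W' W)
    {c : W.rationalTateModule ℓ →ₗ[ℚ_[ℓ]] W'.rationalTateModule ℓ}
    (hc : c ∈ Submodule.span ℚ_[ℓ] (Set.range (fun φ : Isogeny W W' ↦
      (Literature.NumberTheory.EllipticCurves.TateModule.map ℓ φ.toAddMonoidHom).baseChange ℚ_[ℓ]) :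
        Set (W.rationalTateModule ℓ →ₗ[ℚ_[ℓ]] W'.rationalTateModule ℓ))) :
    ((Literature.NumberTheory.EllipticCurves.TateModule.map ℓ ψ₀.toAddMonoidHom).baseChange ℚ_[ℓ] :
        W'.rationalTateModule ℓ →ₗ[ℚ_[ℓ]] W.rationalTateModule ℓ) ∘ₗ c ∈ rationalEndSpan W ℓ := by
  refine comp_mem_of_mem_span _ ?_ hc
  rintro _ ⟨φ, rfl⟩
  exact comp_mem_rationalEndSpan ℓ ψ₀ φ

/-- Conjugation `d ↦ (1 ⊗ T_ℓ ψ₀) ∘ d ∘ (1 ⊗ T_ℓ φ₁)` maps `E'_ℓ` into `E_ℓ` (`E'` elliptic).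
[folklore] -/
theorem comp_comp_mem_rationalEndSpan_of_mem [W'.IsElliptic] (ψ₀ : Isogeny W' W)
    (φ₁ : Isogeny W W') {d : Module.End ℚ_[ℓ] (W'.rationalTateModule ℓ)}
    (hd : d ∈ rationalEndSpan W' ℓ) :
    ((Literature.NumberTheory.EllipticCurves.TateModule.map ℓ ψ₀.toAddMonoidHom).baseChange ℚ_[ℓ] :
        W'.rationalTateModule ℓ →ₗ[ℚ_[ℓ]] W.rationalTateModule ℓ) ∘ₗ d ∘ₗ
      ((Literature.NumberTheory.EllipticCurves.TateModule.map ℓ φ₁.toAddMonoidHom).baseChange ℚ_[ℓ] :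
        W.rationalTateModule ℓ →ₗ[ℚ_[ℓ]] W'.rationalTateModule ℓ) ∈ rationalEndSpan W ℓ := by
  rw [rationalEndSpan_def] at hd
  have hd' : d ∘ₗ ((Literature.NumberTheory.EllipticCurves.TateModule.map ℓ φ₁.toAddMonoidHom).baseChange ℚ_[ℓ] :
        W.rationalTateModule ℓ →ₗ[ℚ_[ℓ]] W'.rationalTateModule ℓ) ∈
      Submodule.span ℚ_[ℓ] (Set.range (fun χ : W'.endRing ↦
        ((tateEndRingHom W' ℓ χ).baseChange ℚ_[ℓ] : Module.End ℚ_[ℓ] (W'.rationalTateModule ℓ)) ∘ₗ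
          ((Literature.NumberTheory.EllipticCurves.TateModule.map ℓ φ₁.toAddMonoidHom).baseChange ℚ_[ℓ] :
            W.rationalTateModule ℓ →ₗ[ℚ_[ℓ]] W'.rationalTateModule ℓ)) :
        Set (W.rationalTateModule ℓ →ₗ[ℚ_[ℓ]] W'.rationalTateModule ℓ)) := by
    refine mem_comp_of_mem_span _ ?_ hd
    rintro _ ⟨χ, rfl⟩
    exact Submodule.subset_span ⟨χ, rfl⟩
  refine comp_mem_of_mem_span _ ?_ hd'
  rintro _ ⟨χ, rfl⟩
  exact comp_comp_mem_rationalEndSpan ℓ ψ₀ χ φ₁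

/-- Composition `H_ℓ(E, E') ∘ E_ℓ ⊆ H_ℓ(E, E')` (`E` elliptic). [folklore] -/
theorem comp_mem_span_of_mem_span_of_mem_rationalEndSpan [W.IsElliptic]
    {c : W.rationalTateModule ℓ →ₗ[ℚ_[ℓ]] W'.rationalTateModule ℓ}
    (hc : c ∈ Submodule.span ℚ_[ℓ] (Set.range (fun φ : Isogeny W W' ↦
      (Literature.NumberTheory.EllipticCurves.TateModule.map ℓ φ.toAddMonoidHom).baseChange ℚ_[ℓ]) :
        Set (W.rationalTateModule ℓ →ₗ[ℚ_[ℓ]] W'.rationalTateModule ℓ)))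
    {e : Module.End ℚ_[ℓ] (W.rationalTateModule ℓ)} (he : e ∈ rationalEndSpan W ℓ) :
    c ∘ₗ e ∈ Submodule.span ℚ_[ℓ] (Set.range (fun φ : Isogeny W W' ↦
      (Literature.NumberTheory.EllipticCurves.TateModule.map ℓ φ.toAddMonoidHom).baseChange ℚ_[ℓ]) :
        Set (W.rationalTateModule ℓ →ₗ[ℚ_[ℓ]] W'.rationalTateModule ℓ)) := by
  rw [rationalEndSpan_def] at he
  refine mem_comp_of_mem_span _ ?_ hc
  rintro _ ⟨φ, rfl⟩
  refine comp_mem_of_mem_span _ ?_ he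
  rintro _ ⟨χ, rfl⟩
  exact comp_mem_span_of_mem_endRing ℓ φ χ

end Literature.AlgebraicGeometry.Motives

namespace Literature.AlgebraicGeometry.Motives

open WeierstrassCurve

variable {K : Type u} [Field K] {W W' : WeierstrassCurve K} (ℓ : ℕ) [Fact ℓ.Prime]

/-! ## The `ℚ_ℓ`-form of Korollar 1 from subspace realization for `E × E'` -/

/-- The graph of a `Γ_K`-equivariant `ℚ_ℓ`-linear map `V_ℓ E → V_ℓ E'` is a `Γ_K`-stable
subspace of `V_ℓ E × V_ℓ E'` (diagonal action). [folklore] -/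
theorem graph_stable_of_equivariant_pair
    {G : W.rationalTateModule ℓ →ₗ[ℚ_[ℓ]] W'.rationalTateModule ℓ}
    (hG : ∀ (σ : Field.absoluteGaloisGroup K) (v : W.rationalTateModule ℓ),
      G (rationalGaloisRepTate W ℓ σ v) = rationalGaloisRepTate W' ℓ σ (G v))
    (σ : Field.absoluteGaloisGroup K) (v : W.rationalTateModule ℓ × W'.rationalTateModule ℓ)
    (hv : v ∈ LinearMap.graph G) :
    (rationalGaloisRepTate W ℓ σ v.1, rationalGaloisRepTate W' ℓ σ v.2) ∈ LinearMap.graph G := by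
  rw [LinearMap.mem_graph_iff] at hv ⊢
  simp only [hv, hG]

variable (W W') in
/-- **The `ℚ_ℓ`-form of Faltings' Korollar 1 for `(E, E')` from subspace realization for
`E × E'`** ("Theorem 4 applied to `A₁ × A₂`", read in dimension two). Let `E, E'` be elliptic
curves over a number field `K` and `ℓ` a prime. Assume (`hX`) that every `ℚ_ℓ`-subspace `U` of
`V_ℓ E × V_ℓ E' = V_ℓ(E × E')` stable under the diagonal action of `Γ_K` is the image
`u(V_ℓ E × V_ℓ E')` of an endomorphism `u = (a b; c d) : (x, y) ↦ (a x + b y, c x + d y)` with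
`a ∈ E_ℓ = image(End_K(E) ⊗ ℚ_ℓ)`, `b ∈ H_ℓ(E', E) = image(Hom_K(E', E) ⊗ ℚ_ℓ)`,
`c ∈ H_ℓ(E, E')`, `d ∈ E'_ℓ` — i.e. of an element of
`End_K(E × E') ⊗ ℚ_ℓ = (End_K(E) Hom_K(E',E); Hom_K(E,E') End_K(E')) ⊗ ℚ_ℓ`: Faltings' assertion
"`W` is the image of an idempotent in `End_K(A) ⊗_ℤ ℚ_ℓ`" (§5, proof of Sätze 3–4, from Satz 1
and Satz 2 via Tate's lattice argument and Zarhin's trick) for the abelian surface `A = E × E'`.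
Assume also (`hcomm`) the named fact `W.geomEndRing_comm` (`End_{K̄}(E)` is commutative in
characteristic `0`, Silverman, *AEC*, III.9.4) and (`hdual`) that every isogeny `ψ : E' → E` over
`K` has a partner `φ : E → E'` over `K` with `φ ∘ ψ = [n]` for some integer `n ≥ 1` (the dual
isogeny, *AEC* III.6.1; the named fact `Isogeny.exists_dual` for `(E', E)`). Then every
`Γ_K`-equivariant `ℚ_ℓ`-linear map `G : V_ℓ E → V_ℓ E'` lies in `H_ℓ(E, E')`, the `ℚ_ℓ`-span of
the `1 ⊗ T_ℓ φ`, `φ : E → E'` an isogeny over `K` (`Hom_K(E, E') ⊗ ℚ_ℓ → Hom_{Γ_K}(V_ℓ E, V_ℓ E')`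
is onto). Proof: `hX` applied to the graph of `G` gives `c = G a`, `d = G b`, `a V + b V' = V`.
If there is no isogeny `E' → E` over `K` then `b = 0`, `a` is invertible with `a⁻¹ ∈ E_ℓ`
(`dim V_ℓ E = 2`, `Literature.AlgebraicGeometry.Motives.comp_mem_of_comp_eq_one`) and `G = c a⁻¹ ∈ H_ℓ(E, E') E_ℓ ⊆ H_ℓ(E, E')`.
Otherwise pick `ψ₀ : E' → E`, `φ₁ ∘ ψ₀ = [n]`, `Φ = 1 ⊗ T_ℓ φ₁`, `Ψ = 1 ⊗ T_ℓ ψ₀`; then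
`a, b Φ, Ψ c, Ψ d Φ ∈ E_ℓ` (composites of isogenies, `End_K = {0} ∪ {isogenies}` by the tree's
`mem_geomEndRing_iff_holds`), so `Ψ G ∈ E_ℓ` by the graph argument for a pair
(`Literature.AlgebraicGeometry.Motives.comp_mem_of_graph_eq_range_pair`; `E_ℓ ∋ 1` is commutative by `hcomm`, `dim V_ℓ E = 2` by
the tree's `finrank_rationalTateModule_eq_two_holds`), and `G = n⁻¹ Φ (Ψ G) ∈ Φ E_ℓ ⊆ H_ℓ(E, E')`.
Faltings 1983, §5, Satz 4 with Korollar 1; Tate, Invent. Math. 2 (1966), §2.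
[cite: Faltings1983Endlichkeit, §5, Satz 4, Korollar 1 (proof: "Theorem 4 applied to A₁ × A₂")] -/
theorem mem_span_baseChange_tateModule_map_of_subspaces_pair [NumberField K] [W.IsElliptic]
    [W'.IsElliptic]
    (hX : ∀ U : Submodule ℚ_[ℓ] (W.rationalTateModule ℓ × W'.rationalTateModule ℓ),
      (∀ (σ : Field.absoluteGaloisGroup K) (v : W.rationalTateModule ℓ × W'.rationalTateModule ℓ),
        v ∈ U → (rationalGaloisRepTate W ℓ σ v.1, rationalGaloisRepTate W' ℓ σ v.2) ∈ U) →
      ∃ (a : Module.End ℚ_[ℓ] (W.rationalTateModule ℓ))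
        (b : W'.rationalTateModule ℓ →ₗ[ℚ_[ℓ]] W.rationalTateModule ℓ)
        (c : W.rationalTateModule ℓ →ₗ[ℚ_[ℓ]] W'.rationalTateModule ℓ)
        (d : Module.End ℚ_[ℓ] (W'.rationalTateModule ℓ)),
        a ∈ rationalEndSpan W ℓ ∧
        b ∈ Submodule.span ℚ_[ℓ] (Set.range (fun ψ : Isogeny W' W ↦
          (Literature.NumberTheory.EllipticCurves.TateModule.map ℓ ψ.toAddMonoidHom).baseChange ℚ_[ℓ]) :
            Set (W'.rationalTateModule ℓ →ₗ[ℚ_[ℓ]] W.rationalTateModule ℓ)) ∧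
        c ∈ Submodule.span ℚ_[ℓ] (Set.range (fun φ : Isogeny W W' ↦
          (Literature.NumberTheory.EllipticCurves.TateModule.map ℓ φ.toAddMonoidHom).baseChange ℚ_[ℓ]) :
            Set (W.rationalTateModule ℓ →ₗ[ℚ_[ℓ]] W'.rationalTateModule ℓ)) ∧
        d ∈ rationalEndSpan W' ℓ ∧
        U = LinearMap.range ((a.coprod b).prod (c.coprod d)))
    (hcomm : W.geomEndRing_comm)
    (hdual : ∀ ψ : Isogeny W' W, ∃ (φ : Isogeny W W') (n : ℕ), n ≠ 0 ∧
      ∀ Q, φ (ψ Q) = (n : ℤ) • Q)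
    (G : W.rationalTateModule ℓ →ₗ[ℚ_[ℓ]] W'.rationalTateModule ℓ)
    (hG : ∀ (σ : Field.absoluteGaloisGroup K) (v : W.rationalTateModule ℓ),
      G (rationalGaloisRepTate W ℓ σ v) = rationalGaloisRepTate W' ℓ σ (G v)) :
    G ∈ Submodule.span ℚ_[ℓ] (Set.range (fun φ : Isogeny W W' ↦
      (Literature.NumberTheory.EllipticCurves.TateModule.map ℓ φ.toAddMonoidHom).baseChange ℚ_[ℓ]) :
        Set (W.rationalTateModule ℓ →ₗ[ℚ_[ℓ]] W'.rationalTateModule ℓ)) := by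
  have hℓK : ((ℓ : ℕ) : K) ≠ 0 := Nat.cast_ne_zero.mpr (Fact.out : ℓ.Prime).ne_zero
  have h2 : Module.finrank ℚ_[ℓ] (W.rationalTateModule ℓ) = 2 :=
    finrank_rationalTateModule_eq_two_holds W ℓ hℓK
  obtain ⟨a, b, c, d, ha, hb, hc, hd, hU⟩ := hX _ (graph_stable_of_equivariant_pair ℓ hG)
  obtain ⟨hkey, hsurj⟩ := forall_of_graph_eq_range hU
  by_cases hne : Nonempty (Isogeny W' W)
  · -- an isogeny `ψ₀ : E' → E` and its partner `φ₁ : E → E'`, `φ₁ ∘ ψ₀ = [n]`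
    obtain ⟨ψ₀⟩ := hne
    obtain ⟨φ₁, n, hn, hφψ⟩ := hdual ψ₀
    have hn' : (n : ℚ_[ℓ]) ≠ 0 := Nat.cast_ne_zero.mpr hn
    have hΦΨ := baseChange_tateModule_map_comp_eq_smul ℓ hφψ
    have hΨG := comp_mem_of_graph_eq_range_pair h2 (one_mem_rationalEndSpan W ℓ)
      (fun s hs t ht ↦ commute_of_mem_span_range_baseChange_tateEndRingHom W ℓ hcomm hs ht)
      hn' hΦΨ ha (comp_mem_rationalEndSpan_of_mem_span ℓ φ₁ hb)
      (comp_mem_rationalEndSpan_of_mem_span' ℓ ψ₀ hc)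
      (comp_comp_mem_rationalEndSpan_of_mem ℓ ψ₀ φ₁ hd) hU
    -- `G = n⁻¹ Φ (Ψ G)`
    have hGeq : G = (n : ℚ_[ℓ])⁻¹ •
        (((Literature.NumberTheory.EllipticCurves.TateModule.map ℓ φ₁.toAddMonoidHom).baseChange ℚ_[ℓ] :
            W.rationalTateModule ℓ →ₗ[ℚ_[ℓ]] W'.rationalTateModule ℓ) ∘ₗ
          (((Literature.NumberTheory.EllipticCurves.TateModule.map ℓ ψ₀.toAddMonoidHom).baseChange ℚ_[ℓ] :
              W'.rationalTateModule ℓ →ₗ[ℚ_[ℓ]] W.rationalTateModule ℓ) ∘ₗ G)) := by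
      rw [← LinearMap.comp_assoc, hΦΨ, LinearMap.smul_comp, LinearMap.id_comp, smul_smul,
        inv_mul_cancel₀ hn', one_smul]
    rw [hGeq]
    refine Submodule.smul_mem _ _ ?_
    exact comp_mem_span_of_mem_span_of_mem_rationalEndSpan ℓ
      (Submodule.subset_span ⟨φ₁, rfl⟩) hΨG
  · -- no isogeny `E' → E`: `b = 0`, `a` is invertible and `G = c a⁻¹`
    have hb0 : b = 0 := by
      haveI : IsEmpty (Isogeny W' W) := not_nonempty_iff.mp hne
      rw [Set.range_eq_empty, Submodule.span_empty] at hb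
      exact (Submodule.mem_bot ℚ_[ℓ]).mp hb
    haveI : FiniteDimensional ℚ_[ℓ] (W.rationalTateModule ℓ) := Module.finite_of_finrank_eq_succ h2
    have hrange : LinearMap.range a = ⊤ := LinearMap.range_eq_top.mpr fun v ↦ by
      obtain ⟨x, y, hxy⟩ := hsurj v
      rw [hb0, LinearMap.zero_apply, add_zero] at hxy
      exact ⟨x, hxy⟩
    obtain ⟨u, hu⟩ := (LinearMap.isUnit_iff_range_eq_top a).mpr hrange
    have hinv : a * ↑u⁻¹ = 1 := by rw [← hu, Units.mul_inv]
    have hinv' : ↑u⁻¹ * a = 1 := by rw [← hu, Units.inv_mul]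
    have ha' : (↑u⁻¹ : Module.End ℚ_[ℓ] (W.rationalTateModule ℓ)) ∈ rationalEndSpan W ℓ :=
      comp_mem_of_comp_eq_one h2 (one_mem_rationalEndSpan W ℓ) ha hinv hinv'
    have hca : ∀ x, c x = G (a x) := fun x ↦ by
      simpa [hb0] using hkey x 0
    have hGeq : G = c ∘ₗ (↑u⁻¹ : Module.End ℚ_[ℓ] (W.rationalTateModule ℓ)) := by
      refine LinearMap.ext fun v ↦ ?_
      rw [LinearMap.comp_apply, hca]
      exact congrArg G (LinearMap.congr_fun hinv v).symm
    rw [hGeq]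
    exact comp_mem_span_of_mem_span_of_mem_rationalEndSpan ℓ hc ha'

/-! ## Korollar 1 over `ℤ_ℓ` from its `ℚ_ℓ`-form: clearing denominators and saturation -/

variable (W W') in
/-- **"It suffices to prove the `ℚ_ℓ`-statement"**, for `Hom`: assume (`hA`) that every
`ℚ_ℓ`-linear map `V_ℓ E → V_ℓ E'` (`V_ℓ = ℚ_ℓ ⊗_{ℤ_ℓ} T_ℓ`) intertwining the base-changed actions
of `Γ_K` lies in the `ℚ_ℓ`-span of the base-changed `T_ℓ φ`, `φ : E → E'` an isogeny over `K`
(surjectivity of `Hom_K(E, E') ⊗ ℚ_ℓ → Hom_{Γ_K}(V_ℓ E, V_ℓ E')`), and (`hB`) that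
`S = ℤ_ℓ · {T_ℓ φ}` is saturated in `Hom_{ℤ_ℓ}(T_ℓ E, T_ℓ E')` (`b g ∈ S`, `b ≠ 0` ⟹ `g ∈ S`).
Then every `Γ_K`-equivariant `ℤ_ℓ`-linear `f : T_ℓ E → T_ℓ E'` lies in `S`: `1 ⊗ f = Σ c_φ (1 ⊗ T_ℓ φ)`
with `c_φ ∈ ℚ_ℓ`; clearing denominators (`IsLocalization.exist_integer_multiples`),
`1 ⊗ (b f) = 1 ⊗ Σ a_φ T_ℓ φ` with `b ≠ 0`, `a_φ ∈ ℤ_ℓ`; base change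
`Hom_{ℤ_ℓ}(T_ℓ E, T_ℓ E') → Hom_{ℚ_ℓ}(V_ℓ E, V_ℓ E')` is injective because `T_ℓ E'` is torsion-free,
hence flat, over `ℤ_ℓ` (`LinearMap.baseChangeHom_injective`); so `b f ∈ S` and `f ∈ S`. The
two-curve form of the first paragraph of Faltings' proof of Sätze 3–4 (the tree's
`mem_span_range_tateEndRingHom_of_rational` is the case `E' = E`).
[cite: Faltings1983Endlichkeit, §5, proof of Satz 3 and Satz 4 (first paragraph)] -/
theorem mem_span_range_tateModule_map_of_rational
    (hA : ∀ G : ℚ_[ℓ] ⊗[ℤ_[ℓ]] W.tateModule ℓ →ₗ[ℚ_[ℓ]] ℚ_[ℓ] ⊗[ℤ_[ℓ]] W'.tateModule ℓ,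
      (∀ σ : Field.absoluteGaloisGroup K,
        G ∘ₗ (galoisRepTate W ℓ σ).baseChange ℚ_[ℓ] =
          (galoisRepTate W' ℓ σ).baseChange ℚ_[ℓ] ∘ₗ G) →
      G ∈ Submodule.span ℚ_[ℓ]
        (Set.range fun φ : Isogeny W W' ↦ (Literature.NumberTheory.EllipticCurves.TateModule.map ℓ φ.toAddMonoidHom).baseChange ℚ_[ℓ]))
    (hB : ∀ (b : ℤ_[ℓ]) (g : W.tateModule ℓ →ₗ[ℤ_[ℓ]] W'.tateModule ℓ), b ≠ 0 →
      b • g ∈ Submodule.span ℤ_[ℓ]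
        (Set.range fun φ : Isogeny W W' ↦ Literature.NumberTheory.EllipticCurves.TateModule.map ℓ φ.toAddMonoidHom) →
      g ∈ Submodule.span ℤ_[ℓ]
        (Set.range fun φ : Isogeny W W' ↦ Literature.NumberTheory.EllipticCurves.TateModule.map ℓ φ.toAddMonoidHom))
    {f : W.tateModule ℓ →ₗ[ℤ_[ℓ]] W'.tateModule ℓ}
    (hf : ∀ (σ : Field.absoluteGaloisGroup K) (x : W.tateModule ℓ), f (σ • x) = σ • f x) :
    f ∈ Submodule.span ℤ_[ℓ]
      (Set.range fun φ : Isogeny W W' ↦ Literature.NumberTheory.EllipticCurves.TateModule.map ℓ φ.toAddMonoidHom) := by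
  have hcomm : ∀ σ : Field.absoluteGaloisGroup K,
      f ∘ₗ galoisRepTate W ℓ σ = galoisRepTate W' ℓ σ ∘ₗ f :=
    fun σ ↦ LinearMap.ext fun x ↦ hf σ x
  have hG : ∀ σ : Field.absoluteGaloisGroup K,
      f.baseChange ℚ_[ℓ] ∘ₗ (galoisRepTate W ℓ σ).baseChange ℚ_[ℓ] =
        (galoisRepTate W' ℓ σ).baseChange ℚ_[ℓ] ∘ₗ f.baseChange ℚ_[ℓ] := fun σ ↦ by
    rw [← LinearMap.baseChange_comp, ← LinearMap.baseChange_comp, hcomm σ]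
  obtain ⟨c, hc⟩ := Finsupp.mem_span_range_iff_exists_finsupp.mp (hA _ hG)
  -- clear denominators: `b • c φ = a φ ∈ ℤ_ℓ` on the support of `c`
  obtain ⟨⟨b, hb0⟩, hint⟩ :=
    IsLocalization.exist_integer_multiples (nonZeroDivisors ℤ_[ℓ]) c.support c
  have hint' : ∀ φ ∈ c.support, ∃ a : ℤ_[ℓ], algebraMap ℤ_[ℓ] ℚ_[ℓ] a = b • c φ :=
    fun φ hφ ↦ hint φ hφ
  choose! a ha using hint'
  refine hB b f (nonZeroDivisors.ne_zero hb0) ?_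
  -- `b • f = Σ a φ • T_ℓ φ`, by injectivity of base change (`T_ℓ E'` is flat over `ℤ_ℓ`)
  have key : b • f = ∑ φ ∈ c.support, a φ • Literature.NumberTheory.EllipticCurves.TateModule.map ℓ φ.toAddMonoidHom := by
    apply LinearMap.baseChangeHom_injective ℤ_[ℓ] (W.tateModule ℓ) ℚ_[ℓ]
    simp only [map_smul, map_sum, LinearMap.baseChangeHom_apply]
    rw [← hc, Finsupp.sum, Finset.smul_sum]
    refine Finset.sum_congr rfl fun φ hφ ↦ ?_
    rw [← algebraMap_smul ℚ_[ℓ] (a φ), ha φ hφ, smul_assoc]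
  rw [key]
  exact Submodule.sum_mem _ fun φ _ ↦ Submodule.smul_mem _ _ (Submodule.subset_span ⟨φ, rfl⟩)

variable (W W') in
/-- **Faltings' Korollar 1 for `(E, E')` from its `ℚ_ℓ`-form and *AEC* III.4.11.** For
Weierstrass curves `W, W'` over `K` and a prime `ℓ`, the named fact
`mem_span_range_tateModule_map_of_equivariant W W' ℓ` (for `E, E'` elliptic over a number field,
every `Γ_K`-equivariant `ℤ_ℓ`-linear `T_ℓ E → T_ℓ E'` is a `ℤ_ℓ`-combination of the `T_ℓ φ`,
`φ : E → E'` an isogeny over `K`) follows from (`hA`) its `ℚ_ℓ`-form — every `Γ_K`-equivariant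
`ℚ_ℓ`-linear `V_ℓ E → V_ℓ E'` lies in `H_ℓ(E, E')`, the `ℚ_ℓ`-span of the `1 ⊗ T_ℓ φ` — and
(`h411`) the named fact `Isogeny.exists_eq_comp_nsmul_of_geomTorsion_le_ker W W'` (*AEC*
Cor. III.4.11), through which the tree proves that `ℤ_ℓ · {T_ℓ φ}` is `ℓ`-saturated in
`Hom(T_ℓ E, T_ℓ E')` (`mem_span_tateModule_map_of_smul_mem`, `FaltingsECTateLemma1Proofs`: Tate
1966, §1, Lemma 1), hence saturated (`Literature.AlgebraicGeometry.Motives.mem_of_padicInt_smul_mem`); conclude by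
`mem_span_range_tateModule_map_of_rational`.
[cite: Faltings1983Endlichkeit, §5, Satz 4, Korollar 1 (with the first paragraph of the proof of Sätze 3–4)] -/
theorem mem_span_range_tateModule_map_of_equivariant_of_rational
    (hA : ∀ [NumberField K] [W.IsElliptic] [W'.IsElliptic]
      (G : W.rationalTateModule ℓ →ₗ[ℚ_[ℓ]] W'.rationalTateModule ℓ),
      (∀ (σ : Field.absoluteGaloisGroup K) (v : W.rationalTateModule ℓ),
        G (rationalGaloisRepTate W ℓ σ v) = rationalGaloisRepTate W' ℓ σ (G v)) →
      G ∈ Submodule.span ℚ_[ℓ] (Set.range (fun φ : Isogeny W W' ↦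
        (Literature.NumberTheory.EllipticCurves.TateModule.map ℓ φ.toAddMonoidHom).baseChange ℚ_[ℓ]) :
          Set (W.rationalTateModule ℓ →ₗ[ℚ_[ℓ]] W'.rationalTateModule ℓ)))
    (h411 : Isogeny.exists_eq_comp_nsmul_of_geomTorsion_le_ker W W') :
    mem_span_range_tateModule_map_of_equivariant W W' ℓ := by
  intro _ _ _ f hf
  have hℓK : ((ℓ : ℕ) : K) ≠ 0 := Nat.cast_ne_zero.mpr (Fact.out : ℓ.Prime).ne_zero
  have hB : ∀ (b : ℤ_[ℓ]) (g : W.tateModule ℓ →ₗ[ℤ_[ℓ]] W'.tateModule ℓ), b ≠ 0 →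
      b • g ∈ Submodule.span ℤ_[ℓ]
        (Set.range fun φ : Isogeny W W' ↦ Literature.NumberTheory.EllipticCurves.TateModule.map ℓ φ.toAddMonoidHom) →
      g ∈ Submodule.span ℤ_[ℓ]
        (Set.range fun φ : Isogeny W W' ↦ Literature.NumberTheory.EllipticCurves.TateModule.map ℓ φ.toAddMonoidHom) :=
    fun b g hb hbg ↦ mem_of_padicInt_smul_mem
      (fun g' hg' ↦ mem_span_tateModule_map_of_smul_mem ℓ hℓK h411 hg') hb hbg
  exact mem_span_range_tateModule_map_of_rational W W' ℓ
    (fun G hG ↦ hA G fun σ v ↦ LinearMap.congr_fun (hG σ) v) hB hf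

/-! ## Korollar 1 for `(E, E')` from subspace realization for `E × E'`, assembled -/

variable (W W') in
/-- **Faltings' Korollar 1 for `(E, E')` from subspace realization for `E × E'` and the
elementary theory of isogenies.** For Weierstrass curves `W, W'` over `K` and a prime `ℓ`, the
named fact `mem_span_range_tateModule_map_of_equivariant W W' ℓ` (Faltings 1983, §5, Satz 4,
Korollar 1, elliptic-curve case: `Hom_K(E, E') ⊗ ℤ_ℓ → Hom_{Γ_K}(T_ℓ E, T_ℓ E')` is onto)
follows from:
(`hX`) for `E, E'` elliptic over the number field `K`, every `Γ_K`-stable `ℚ_ℓ`-subspace of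
`V_ℓ E × V_ℓ E'` is the image of an endomorphism `(a b; c d)` with `a ∈ E_ℓ`, `b ∈ H_ℓ(E', E)`,
`c ∈ H_ℓ(E, E')`, `d ∈ E'_ℓ` — Faltings' "`W` is the image of an idempotent in
`End_K(A) ⊗ ℚ_ℓ`" for the abelian surface `A = E × E'` of the printed proof of Korollar 1
("Theorem 4 applied to `A₁ × A₂`"), the one deep input (Sätze 1–2 resp. Satz 6, and Tate's
lattice argument);
(`hcomm`) the named fact `W.geomEndRing_comm` (*AEC* III.9.4);
(`hdual`) the named fact `Isogeny.exists_dual` for isogenies `E' → E` (*AEC* III.6.1);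
(`h411`) the named fact `Isogeny.exists_eq_comp_nsmul_of_geomTorsion_le_ker W W'`
(*AEC* III.4.11).
The `ℚ_ℓ`-form is `mem_span_baseChange_tateModule_map_of_subspaces_pair`, the descent to `ℤ_ℓ` is
`mem_span_range_tateModule_map_of_equivariant_of_rational`; `End_K = {0} ∪ {isogenies}`,
composites of isogenies and `dim V_ℓ E = 2` are supplied by the tree
(`mem_geomEndRing_iff_holds`, `Isogeny.nonempty_comp_holds`,
`finrank_rationalTateModule_eq_two_holds`). Compared with
`mem_span_range_tateModule_map_of_equivariant_of_subspaces` (`FaltingsECTateHomProofs`), Korollar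
2 for `(E, E')` is no longer an input.
[cite: Faltings1983Endlichkeit, §5, Satz 4, Korollar 1] -/
theorem mem_span_range_tateModule_map_of_equivariant_of_subspaces_pair
    (hX : ∀ [NumberField K] [W.IsElliptic] [W'.IsElliptic]
      (U : Submodule ℚ_[ℓ] (W.rationalTateModule ℓ × W'.rationalTateModule ℓ)),
      (∀ (σ : Field.absoluteGaloisGroup K) (v : W.rationalTateModule ℓ × W'.rationalTateModule ℓ),
        v ∈ U → (rationalGaloisRepTate W ℓ σ v.1, rationalGaloisRepTate W' ℓ σ v.2) ∈ U) →
      ∃ (a : Module.End ℚ_[ℓ] (W.rationalTateModule ℓ))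
        (b : W'.rationalTateModule ℓ →ₗ[ℚ_[ℓ]] W.rationalTateModule ℓ)
        (c : W.rationalTateModule ℓ →ₗ[ℚ_[ℓ]] W'.rationalTateModule ℓ)
        (d : Module.End ℚ_[ℓ] (W'.rationalTateModule ℓ)),
        a ∈ rationalEndSpan W ℓ ∧
        b ∈ Submodule.span ℚ_[ℓ] (Set.range (fun ψ : Isogeny W' W ↦
          (Literature.NumberTheory.EllipticCurves.TateModule.map ℓ ψ.toAddMonoidHom).baseChange ℚ_[ℓ]) :
            Set (W'.rationalTateModule ℓ →ₗ[ℚ_[ℓ]] W.rationalTateModule ℓ)) ∧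
        c ∈ Submodule.span ℚ_[ℓ] (Set.range (fun φ : Isogeny W W' ↦
          (Literature.NumberTheory.EllipticCurves.TateModule.map ℓ φ.toAddMonoidHom).baseChange ℚ_[ℓ]) :
            Set (W.rationalTateModule ℓ →ₗ[ℚ_[ℓ]] W'.rationalTateModule ℓ)) ∧
        d ∈ rationalEndSpan W' ℓ ∧
        U = LinearMap.range ((a.coprod b).prod (c.coprod d)))
    (hcomm : W.geomEndRing_comm) (hdual : Isogeny.exists_dual (W := W') (W' := W))
    (h411 : Isogeny.exists_eq_comp_nsmul_of_geomTorsion_le_ker W W') :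
    mem_span_range_tateModule_map_of_equivariant W W' ℓ := by
  refine mem_span_range_tateModule_map_of_equivariant_of_rational W W' ℓ (fun G hG ↦ ?_) h411
  have hdual' : ∀ ψ : Isogeny W' W, ∃ (φ : Isogeny W W') (n : ℕ), n ≠ 0 ∧
      ∀ Q, φ (ψ Q) = (n : ℤ) • Q := fun ψ ↦ by
    obtain ⟨φ, hφ⟩ := hdual ψ
    exact ⟨φ, ψ.degree, ψ.degree_pos.ne', hφ⟩
  exact mem_span_baseChange_tateModule_map_of_subspaces_pair W W' ℓ hX hcomm hdual' G hG

end Literature.AlgebraicGeometry.Motives
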